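import Summits.BirchSwinnertonDyer.Uniform.U2.TransportARankZeroBoxerDiao
import Summits.BirchSwinnertonDyer.Uniform.U2.TwoTrivialIffOddTrace
import HarnessLib

/-!
# Track U2, route A (cell `bsd-uniform`, seat u2-p1): the Zhai–Boxer–Diao family with the twisting
# condition in the cell's «`a_q` odd» form

HONEST FRAMING (cell `bsd-uniform`, HOME run/shared/lean/pub/bsd-uniform/, verbatim in every file of
the seat): pure composition, nothing booked, no per-curve certificate counted as uniform; converts
PAIRS, never the class X5. `TransportARankZeroBoxerDiao.bsdp_two_twist_of_zhai11_boxerDiao` (Zhai 2016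
Thm 1.1 ∘ Boxer–Diao 2010 Thm 1.1 / Prop 4.1 ∘ route-A kernel ⇒ `BSD(E^{(M)}, 2)`, Zhai's printed
remark) carries Boxer–Diao's binder «`M` is 2-trivial» (no rational `2`-torsion of `E` mod `q`,
`q ∣ M` odd); `TwoTrivialIffOddTrace.isTwoTrivial_iff_forall_odd_frobeniusTrace` PROVES it equivalent
to the cell's / Kriz–Li's «`a_q(E)` odd for every odd prime `q ∣ M`». This file restates the family
theorem with that binder, so that route C / CONVERSIONS can quote the twisting class as
`{M : square-free, M ≡ 1 (4), (M, NΔ) = 1, a_q(E) odd ∀ q ∣ M}` (Zhai's «inert in the cubic field»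
binder `IsInertIn F q` is still carried separately — INGREDIENTS F9; its equivalence with «`a_q` odd»
needs Dedekind–Kummer for the `2`-division cubic, not in this file).

References: Zhai 2016 Thm 1.1 + remark [Zhai2016]; Boxer–Diao 2010 Thm 1.1, Prop 4.1 [BoxerDiao2010].
-/

noncomputable section

open scoped Classical AddSubgroup

open NumberField WeierstrassCurve Literature.NumberTheory.EllipticCurves
  Literature.NumberTheory.EllipticCurves.ModularForms
  Literature.NumberTheory.EllipticCurves.Rank1Residual
  Literature.NumberTheory.EllipticCurves.CoatesLiTianZhai2015
  Literature.NumberTheory.EllipticCurves.Zhai2016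
  Summit.BirchSwinnertonDyer.Rank1Residual

namespace Summit.BirchSwinnertonDyer.Uniform.U2

variable {W : WeierstrassCurve ℚ} [W.IsElliptic] [W.IsGloballyMinimal] [NeZero (W.conductorNorm ℤ)]

/-- **The Zhai–Boxer–Diao family, «`a_q` odd» form.** As `bsdp_two_twist_of_zhai11_boxerDiao`, with
Boxer–Diao's «2-trivial» binder replaced by: `W.frobeniusTrace q` is odd for every odd prime `q ∣ M`
(equivalent, `isTwoTrivial_iff_forall_odd_frobeniusTrace`). Conclusion unchanged: `r_an(E^{(M)}) = 0`,
`rank E^{(M)} = 0`, `Ш(E^{(M)}/ℚ)[2^∞] = 0`, odd Tamagawa product, `BSDp WM 2`.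
[cite: Zhai2016, Thm. 1.1 and the remark after it] [cite: BoxerDiao2010, Thm. 1.1 and Prop. 4.1] -/
theorem bsdp_two_twist_of_zhai11_boxerDiao_of_odd_frobeniusTrace
    (h11 : thm11_ordTwo_LAlg_twist_eq_zero)
    (hBD : BoxerDiao2010.thm11_sel2_twist) (hBD4 : BoxerDiao2010.prop41_tamagawa_twist)
    (hmod : hasEntireLFunction_rat)
    (Dt : ModularParametrizationData W (W.conductorNorm ℤ)) (hopt : Zhai2021.IsOptimalDatum W Dt)
    (hgood : BoxerDiao2010.IsGood W)
    (hL : ∃ x : ℚ, IsLAlg W x ∧ x ≠ 0 ∧ padicValRat 2 x = 0)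
    (F : Type) [Field F] [NumberField F] (hF : IsTwoDivisionField W F)
    (M : ℤ) (hsq : Squarefree M) (hM4 : M % 4 = 1)
    (hgcdN : Int.gcd M (W.conductorNorm ℤ) = 1) (hgcdΔ : Int.gcd M (minimalDiscriminantInt W) = 1)
    (hne : M.natAbs.primeFactors.Nonempty) (hin : ∀ q ∈ M.natAbs.primeFactors, q ≠ 2 ∧ IsInertIn F q)
    (hodd : ∀ (q : ℕ), q.Prime → q ≠ 2 → (q : ℤ) ∣ M → Odd (W.frobeniusTrace q))
    {WM : WeierstrassCurve ℚ} [WM.IsElliptic] [WM.IsGloballyMinimal]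
    (hWM : ∃ C : VariableChange ℚ, C • W.quadraticTwist (M : ℚ) = WM) :
    WM.analyticRank = 0 ∧ WM.mordellWeilRank = 0 ∧ AddCommGroup.primaryComponent WM.sha 2 = ⊥ ∧
      Odd WM.tamagawaProduct ∧ BSDp WM 2 :=
  bsdp_two_twist_of_zhai11_boxerDiao h11 hBD hBD4 hmod Dt hopt hgood hL F hF M hsq hM4 hgcdN hgcdΔ hne
    hin ((isTwoTrivial_iff_forall_odd_frobeniusTrace W M).mpr hodd) hWM

end Summit.BirchSwinnertonDyer.Uniform.U2

end
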